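import Summits.Ventures.PercRepro.ThetaMultiRel

/-!
# (Σ): the all-singleton regime of (Θ_∞)

Dossier proofs/MINE1-theoremS.md, Addendum 76 (mine-1, gen 39). When every class of a (Θ_∞)
instance is a singleton, the multi-class difference family of `ThetaMulti.lean` depends only on the
set `X` of members: it is `∅` together with the meets `x ⊓ y` and the relative co-joins
`U \ (x ⊔ y)` of two **distinct** members (`sigmaD U X`), and validity says that no member is the
relative complement of a member (`SigmaValidRel U X`). **Conjecture (Σ)** (`ConjSigma α`):
`|X| ≤ |sigmaD univ X|` for every valid `X` — the `m = |X|` case of (Θ_∞) for every `m`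
(`conjSigma_of_conjThetaMulti`; the bridge is `sigmaD_image_eq_multiDRel`).

This file types the regime and proves what closes at once:

* `mem_sigmaD`, `empty_mem_sigmaD`, `inf_mem_sigmaD`, `sdiff_sup_mem_sigmaD` — membership;
* `sigmaD_image_eq_multiDRel`, `multiValidRel_singleton_iff_sigmaValidRel` — the bridge to the
  multi-class family with singleton classes `fun i => {x i}`;
* `conjSigma_of_conjThetaMulti` — (Θ_∞) implies (Σ);
* `card_le_card_sigmaD_of_empty_mem`, `card_le_card_sigmaD_of_mem_self` — the extreme regime
  (`∅ ∈ X` or `U ∈ X`) of (Σ) by the explicit injections `x ↦ U \ x` and `x ↦ x`.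
-/

namespace PercRepro.MSTight

open Finset
open scoped FinsetFamily

variable {α : Type*} [DecidableEq α] [Fintype α]

section SigmaDefs

/-- The **(Σ)-difference family** of a set `X` of subsets of `U`, relative to `U`: `∅`, the
meets of two distinct members and the relative co-joins of two distinct members. -/
def sigmaD (U : Finset α) (X : Finset (Finset α)) : Finset (Finset α) :=
  {∅} ∪ X.offDiag.image (fun p => p.1 ⊓ p.2) ∪ X.offDiag.image fun p => U \ (p.1 ⊔ p.2)

/-- **Validity of a (Σ)-instance** relative to `U`: members inside `U`, and no member is the
relative complement of a member. -/
def SigmaValidRel (U : Finset α) (X : Finset (Finset α)) : Prop :=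
  (∀ x ∈ X, x ⊆ U) ∧ Disjoint X (complsRel U X)

/-- **Conjecture (Σ)**: for every valid family `X` of subsets of `α`, `|X| ≤ |sigmaD univ X|` —
the all-singleton case of (Θ_∞) (Addendum 72: census-true on `[3]`–`[5]`; Addendum 76). -/
def ConjSigma (α : Type*) [DecidableEq α] [Fintype α] : Prop :=
  ∀ X : Finset (Finset α), SigmaValidRel univ X → X.card ≤ (sigmaD univ X).card

variable {U : Finset α} {X : Finset (Finset α)}

omit [Fintype α] in
/-- Membership in the (Σ)-difference family. -/
theorem mem_sigmaD {E : Finset α} :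
    E ∈ sigmaD U X ↔ E = ∅ ∨ (∃ x ∈ X, ∃ y ∈ X, x ≠ y ∧ x ⊓ y = E) ∨
      ∃ x ∈ X, ∃ y ∈ X, x ≠ y ∧ U \ (x ⊔ y) = E := by
  unfold sigmaD
  simp only [mem_union, mem_singleton, mem_image, mem_offDiag, Prod.exists]
  constructor
  · rintro ((h | ⟨x, y, ⟨hx, hy, hxy⟩, h⟩) | ⟨x, y, ⟨hx, hy, hxy⟩, h⟩)
    · exact Or.inl h
    · exact Or.inr (Or.inl ⟨x, hx, y, hy, hxy, h⟩)
    · exact Or.inr (Or.inr ⟨x, hx, y, hy, hxy, h⟩)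
  · rintro (h | ⟨x, hx, y, hy, hxy, h⟩ | ⟨x, hx, y, hy, hxy, h⟩)
    · exact Or.inl (Or.inl h)
    · exact Or.inl (Or.inr ⟨x, y, ⟨hx, hy, hxy⟩, h⟩)
    · exact Or.inr ⟨x, y, ⟨hx, hy, hxy⟩, h⟩

omit [Fintype α] in
/-- `∅` is always in the family. -/
theorem empty_mem_sigmaD (U : Finset α) (X : Finset (Finset α)) : ∅ ∈ sigmaD U X :=
  mem_sigmaD.2 (Or.inl rfl)

omit [Fintype α] in
/-- The meet of two distinct members is in the family. -/
theorem inf_mem_sigmaD {x y : Finset α} (hxy : x ≠ y) (hx : x ∈ X) (hy : y ∈ X) :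
    x ⊓ y ∈ sigmaD U X :=
  mem_sigmaD.2 (Or.inr (Or.inl ⟨x, hx, y, hy, hxy, rfl⟩))

omit [Fintype α] in
/-- The relative co-join of two distinct members is in the family. -/
theorem sdiff_sup_mem_sigmaD {x y : Finset α} (hxy : x ≠ y) (hx : x ∈ X) (hy : y ∈ X) :
    U \ (x ⊔ y) ∈ sigmaD U X :=
  mem_sigmaD.2 (Or.inr (Or.inr ⟨x, hx, y, hy, hxy, rfl⟩))

omit [Fintype α] in
/-- A valid instance has no member together with its relative complement. -/
theorem sdiff_notMem_of_sigmaValidRel (hv : SigmaValidRel U X) {x : Finset α} (hx : x ∈ X) :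
    U \ x ∉ X := fun h =>
  disjoint_left.1 hv.2 h (mem_complsRel.2 ⟨x, hx, rfl⟩)

end SigmaDefs

section Bridge

variable {ι : Type*} [DecidableEq ι] [Fintype ι] {U : Finset α}

omit [Fintype α] in
/-- **The bridge**: the multi-class family of the singleton classes `fun i => {x i}` of an
injective `x` is the (Σ)-family of the set of members. -/
theorem sigmaD_image_eq_multiDRel (x : ι → Finset α) (hx : Function.Injective x) :
    sigmaD U (univ.image x) = multiDRel U fun i => {x i} := by
  ext E
  rw [mem_sigmaD, mem_multiDRel]
  simp only [mem_image, mem_univ, true_and, mem_diffs, mem_singleton, mem_crossDRel,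
    exists_eq_left, sdiff_self, bot_eq_empty]
  constructor
  · rintro (h | ⟨a, ⟨i, rfl⟩, b, ⟨j, rfl⟩, hab, h⟩ | ⟨a, ⟨i, rfl⟩, b, ⟨j, rfl⟩, hab, h⟩)
    · exact Or.inl h
    · exact Or.inr (Or.inr ⟨i, j, fun hij => hab (hij ▸ rfl), Or.inl h⟩)
    · exact Or.inr (Or.inr ⟨i, j, fun hij => hab (hij ▸ rfl), Or.inr h⟩)
  · rintro (h | ⟨i, h⟩ | ⟨i, j, hij, h | h⟩)
    · exact Or.inl h
    · exact Or.inl h.symm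
    · exact Or.inr (Or.inl ⟨x i, ⟨i, rfl⟩, x j, ⟨j, rfl⟩, fun h' => hij (hx h'), h⟩)
    · exact Or.inr (Or.inr ⟨x i, ⟨i, rfl⟩, x j, ⟨j, rfl⟩, fun h' => hij (hx h'), h⟩)

omit [Fintype α] in
/-- Validity of the singleton classes is validity of the set of members. -/
theorem multiValidRel_singleton_iff_sigmaValidRel (x : ι → Finset α) (hx : Function.Injective x) :
    MultiValidRel U (fun i => {x i}) ↔ SigmaValidRel U (univ.image x) := by
  constructor
  · rintro ⟨hsub, hself, hcross⟩
    refine ⟨?_, ?_⟩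
    · rintro z hz
      obtain ⟨i, -, rfl⟩ := mem_image.1 hz
      exact hsub i (x i) (mem_singleton_self _)
    · rw [disjoint_left]
      rintro z hz hzc
      obtain ⟨i, -, rfl⟩ := mem_image.1 hz
      obtain ⟨w, hw, hzw⟩ := mem_complsRel.1 hzc
      obtain ⟨j, -, rfl⟩ := mem_image.1 hw
      by_cases hij : i = j
      · subst hij
        exact disjoint_left.1 (hself i) (mem_singleton_self _)
          (mem_complsRel.2 ⟨x i, mem_singleton_self _, hzw⟩)
      · exact disjoint_left.1 (hcross i j hij).2 (mem_singleton_self _)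
          (mem_complsRel.2 ⟨x j, mem_singleton_self _, hzw⟩)
  · rintro ⟨hsub, hdisj⟩
    refine ⟨?_, ?_, ?_⟩
    · intro i z hz
      rw [mem_singleton] at hz
      exact hsub z (hz ▸ mem_image.2 ⟨i, mem_univ i, rfl⟩)
    · intro i
      rw [disjoint_left]
      intro z hz hzc
      rw [mem_singleton] at hz
      obtain ⟨w, hw, hzw⟩ := mem_complsRel.1 hzc
      rw [mem_singleton] at hw
      subst hw
      subst hz
      exact disjoint_left.1 hdisj (mem_image.2 ⟨i, mem_univ i, rfl⟩)
        (mem_complsRel.2 ⟨x i, mem_image.2 ⟨i, mem_univ i, rfl⟩, hzw⟩)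
    · intro i j hij
      refine ⟨?_, ?_⟩
      · rw [disjoint_left]
        intro z hz hz'
        rw [mem_singleton] at hz hz'
        exact hij (hx (hz ▸ hz'))
      · rw [disjoint_left]
        intro z hz hzc
        rw [mem_singleton] at hz
        obtain ⟨w, hw, hzw⟩ := mem_complsRel.1 hzc
        rw [mem_singleton] at hw
        subst hw
        subst hz
        exact disjoint_left.1 hdisj (mem_image.2 ⟨i, mem_univ i, rfl⟩)
          (mem_complsRel.2 ⟨x j, mem_image.2 ⟨j, mem_univ j, rfl⟩, hzw⟩)

/-- **(Θ_∞) implies (Σ)**: the all-singleton instances are instances. -/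
theorem conjSigma_of_conjThetaMulti (h : ConjThetaMulti α) : ConjSigma α := by
  intro X hv
  -- enumerate the members
  set x : Fin X.card → Finset α := fun i => (X.equivFin.symm i).1 with hxdef
  have hinj : Function.Injective x := by
    intro i j hij
    exact X.equivFin.symm.injective (Subtype.ext hij)
  have himg : univ.image x = X := by
    ext z
    simp only [mem_image, mem_univ, true_and, hxdef]
    constructor
    · rintro ⟨i, rfl⟩
      exact (X.equivFin.symm i).2
    · intro hz
      exact ⟨X.equivFin ⟨z, hz⟩, by simp⟩
  have hvalid : MultiValid fun i => {x i} := by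
    rw [← multiValidRel_univ, multiValidRel_singleton_iff_sigmaValidRel x hinj, himg]
    exact hv
  have hconj := h X.card (fun i => {x i}) hvalid
  rw [← multiDRel_univ, ← sigmaD_image_eq_multiDRel x hinj, himg] at hconj
  simpa only [card_singleton, sum_const, card_univ, Fintype.card_fin, smul_eq_mul, mul_one]
    using hconj

end Bridge

section Extreme

variable {U : Finset α} {X : Finset (Finset α)}

omit [Fintype α] in
/-- **The `∅`-regime of (Σ)**: if `∅ ∈ X`, then `x ↦ U \ x` (the co-join with `∅`) injects
`X ∖ {∅}` into the family, so `|X| ≤ |sigmaD U X|`. -/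
theorem card_le_card_sigmaD_of_empty_mem (hv : SigmaValidRel U X) (h0 : ∅ ∈ X) :
    X.card ≤ (sigmaD U X).card := by
  have hU : U ∉ X := by
    have := sdiff_notMem_of_sigmaValidRel hv h0
    rwa [sdiff_empty] at this
  -- the injection `f`: `∅ ↦ ∅`, `x ↦ U \ x` otherwise
  let f : Finset α → Finset α := fun x => if x = ∅ then ∅ else U \ x
  have hmaps : ∀ x ∈ X, f x ∈ sigmaD U X := by
    intro x hx
    by_cases hx0 : x = ∅
    · simp only [f, hx0, if_true]
      exact empty_mem_sigmaD U X
    · simp only [f, hx0, if_false]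
      have := sdiff_sup_mem_sigmaD (U := U) (Ne.symm hx0) h0 hx
      rwa [sup_eq_union, empty_union] at this
  -- `U \ y = ∅` is impossible for a member `y`: it would force `y = U`
  have hne : ∀ y ∈ X, U \ y ≠ ∅ := by
    intro y hy h
    rw [sdiff_eq_empty_iff_subset] at h
    exact hU ((Finset.Subset.antisymm (hv.1 y hy) h) ▸ hy)
  have hinj : Set.InjOn f X := by
    intro x hx y hy hxy
    by_cases hx0 : x = ∅ <;> by_cases hy0 : y = ∅
    · rw [hx0, hy0]
    · simp only [f, hx0, hy0, if_true, if_false] at hxy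
      exact absurd hxy.symm (hne y hy)
    · simp only [f, hx0, hy0, if_true, if_false] at hxy
      exact absurd hxy (hne x hx)
    · simp only [f, hx0, hy0, if_false] at hxy
      have hxs := hv.1 x hx
      have hys := hv.1 y hy
      rw [← Finset.sdiff_sdiff_eq_self hxs, hxy, Finset.sdiff_sdiff_eq_self hys]
  exact card_le_card_of_injOn f hmaps hinj

omit [Fintype α] in
/-- **The `U`-regime of (Σ)**: if `U ∈ X`, then `x ↦ x` (the meet with `U`) and `U ↦ ∅` inject
`X` into the family, so `|X| ≤ |sigmaD U X|`. -/
theorem card_le_card_sigmaD_of_mem_self (hv : SigmaValidRel U X) (hU : U ∈ X) :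
    X.card ≤ (sigmaD U X).card := by
  have h0 : ∅ ∉ X := by
    have := sdiff_notMem_of_sigmaValidRel hv hU
    rwa [sdiff_self, bot_eq_empty] at this
  let f : Finset α → Finset α := fun x => if x = U then ∅ else x
  have hmaps : ∀ x ∈ X, f x ∈ sigmaD U X := by
    intro x hx
    by_cases hxU : x = U
    · simp only [f, hxU, if_true]
      exact empty_mem_sigmaD U X
    · simp only [f, hxU, if_false]
      have := inf_mem_sigmaD (U := U) (Ne.symm hxU) hU hx
      rwa [inf_eq_inter, inter_eq_right.2 (hv.1 x hx)] at this
  have hinj : Set.InjOn f X := by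
    intro x hx y hy hxy
    by_cases hxU : x = U <;> by_cases hyU : y = U
    · rw [hxU, hyU]
    · simp only [f, hxU, hyU, if_true, if_false] at hxy
      exact absurd (hxy ▸ hy) h0
    · simp only [f, hxU, hyU, if_true, if_false] at hxy
      exact absurd (hxy.symm ▸ hx) h0
    · simpa only [f, hxU, hyU, if_false] using hxy
  exact card_le_card_of_injOn f hmaps hinj

end Extreme

end PercRepro.MSTight
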